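import Summits.QuantumFields.YangMills.Theorems.AtomicCalibrationRAtomCeilingsTransport
import Summits.QuantumFields.YangMills.Theorems.AtomicCalibrationRMirrorCalibrationOnset
import HarnessLib

/-!
# E3 part 1/3 — tensor-atom slots are route atoms; carriers; the separating integer hyperplane

* H2a `atom_sample`: `b(σ⁻¹ • (a•x + (a/2)•(e_{q.1}+e_{q.2}) − η)) = atomWt b {q} (a/σ) (σ⁻¹ • η) (q, x)`;
* H3 `carrier_coord` / `carrier_mul` / `separating_plane`: two slots of one LARGE Whitney piece (radius `ρ ≥ a`,
  centres `Λρ`-apart on an axis, `Λ ≥ 4t+12`, atom sizes `≤ ρ`, atom centres within `2ρ`) admit an integer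
  hyperplane with both carriers at lattice distance `≥ tσ/a + 2` on opposite sides (E1's side condition);
* H2b `carrierFinset` (`≤ (2t/s+4)⁴` sites) / `tensorAtom_tsum_eq_piFinset`: the lattice sum of a tensor atom is
  literally 28168's finite cluster sum.
LANDING (LEAD sfw-p2 g74): `atomArg_apply` / `atomWt_ne_zero_iff` are imported from the landed E1 transport / B6 onset files
(`AtomicCalibrationRAtomCeilingsTransport`, `AtomicCalibrationRMirrorCalibrationOnset`); the sup bound is `abs_atomWt_le_norm` here
(the B6 file's `abs_atomWt_le` takes an explicit bound).  Author of the mathematics and the Lean proof: planner ym-idea-11 g15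
(HOME g15/bc/e3_smearedAtomicBound.lean sha 8104de4f, rc 0; landable split g15/land/), landed by the LEAD seat as a service.

HONEST LABEL: helper lemmas / a SUPPORT stub (`stub_smearedAtomicBound`, E3) of LINES «AtomicEngine» /
«MirrorCalibration» on support item stmt-QuantumFields-28169 (ideator ym-idea-11 g15; critic idea-crit-9 #85/#86);
the wall-class items 28126 / 28168 and the open stub E2 enter only as HYPOTHESES; nothing here bears on NT/UV/IR;
no crux / rung / leaf / summit is proved; YM mass gap NOT proved.
-/

set_option autoImplicit false
noncomputable section
open scoped BigOperators
open MeasureTheory Filter Topology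
open Literature.MathematicalPhysics.QuantumFieldTheory Literature.MathematicalPhysics.QuantumLattice
open Literature.MathematicalPhysics.AQFT (IsOffDiagonal)
open Literature.Probability.LatticeModels (Site)
open Summit.QuantumFields.YangMills.Cruxes.OSLegsFromFemtoAndGap.DlrCollarTransfer (plane exists_abs_plane_le)
open Summit.QuantumFields.YangMills.Theorems.InfiniteVolume (stateMomentStr)
open Summit.QuantumFields.YangMills.Theorems.InfVolRP (centreOffset)
open Summit.QuantumFields.YangMills.Theses.OnsetTautology

namespace Summit.QuantumFields.YangMills.Cruxes.AtomicCalibrationR.MirrorCalibration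

variable {G : Type} [Group G] [TopologicalSpace G] [IsTopologicalGroup G] [CompactSpace G]
  [MeasurableSpace G] [BorelSpace G]

/-! ## §H2a Sample points of the smeared functional: tensor-atom slots are route atoms -/

omit [Group G] [TopologicalSpace G] [IsTopologicalGroup G] [CompactSpace G] [MeasurableSpace G] [BorelSpace G] in
/-- The functional's plaquette-centre offset is `a • centreOffset q` (valid orientation). -/
theorem offset_eq_centreOffset {q : Fin 4 × Fin 4} (hq : q.1 < q.2) (a : ℝ) :
    (a / 2) • (EuclideanSpace.single q.1 (1 : ℝ) + EuclideanSpace.single q.2 (1 : ℝ)) = a • centreOffset q := by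
  unfold centreOffset
  rw [if_pos hq, smul_smul]
  congr 1
  ring

omit [Group G] [TopologicalSpace G] [IsTopologicalGroup G] [CompactSpace G] [MeasurableSpace G] [BorelSpace G] in
/-- **H2a.**  At the sample point `a•x + a•o_q` the tensor-atom slot `b(σ⁻¹ • (· − η))` is the route atom of lattice
scale `a/σ` and offset `σ⁻¹ • η`. -/
theorem atom_sample (b : SchwartzMap (EuclideanSpace ℝ (Fin 4)) ℝ) {q : Fin 4 × Fin 4} (hq : q.1 < q.2) (a σ : ℝ)
    (η : EuclideanSpace ℝ (Fin 4)) (x : Site 4) :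
    b (σ⁻¹ • (a • siteToE x + (a / 2) • (EuclideanSpace.single q.1 (1 : ℝ) + EuclideanSpace.single q.2 (1 : ℝ)) - η)) =
      atomWt b {q} (a / σ) (σ⁻¹ • η) (q, x) := by
  unfold atomWt
  dsimp only
  rw [if_pos ⟨Finset.mem_singleton_self q, hq⟩, offset_eq_centreOffset hq, ← smul_add, smul_sub, smul_smul,
    show σ⁻¹ * a = a / σ by rw [div_eq_mul_inv, mul_comm]]

/-! ## §H3 Carriers and the separating integer hyperplane -/

omit [Group G] [TopologicalSpace G] [IsTopologicalGroup G] [CompactSpace G] [MeasurableSpace G] [BorelSpace G] in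
/-- Every component of the centre offset lies in `[0, 1]`. -/
theorem centreOffset_apply_mem (q : Fin 4 × Fin 4) (k : Fin 4) : 0 ≤ centreOffset q k ∧ centreOffset q k ≤ 1 := by
  unfold centreOffset
  split_ifs
  · simp only [PiLp.smul_apply, PiLp.add_apply, PiLp.single_apply, smul_eq_mul]
    constructor <;> split_ifs <;> norm_num
  · simp

omit [Group G] [TopologicalSpace G] [IsTopologicalGroup G] [CompactSpace G] [MeasurableSpace G] [BorelSpace G] in
/-- **Carrier bound.**  A carrier site of the atom `(q, s, y)` (profile support radius `t`) has
`|s(x_k + o_k) − y_k| ≤ t` in every coordinate. -/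
theorem carrier_coord {b : SchwartzMap (EuclideanSpace ℝ (Fin 4)) ℝ} {t : ℝ} (hbt : ∀ u, b u ≠ 0 → ‖u‖ ≤ t)
    {q : Fin 4 × Fin 4} {s : ℝ} {y : EuclideanSpace ℝ (Fin 4)} {p : (Fin 4 × Fin 4) × (Fin 4 → ℤ)}
    (h : atomWt b {q} s y p ≠ 0) (k : Fin 4) :
    |s * (((p.2 k : ℤ) : ℝ) + centreOffset p.1 k) - y k| ≤ t := by
  obtain ⟨-, hb₀⟩ := (atomWt_ne_zero_iff b {q} s y p).1 h
  have hk := PiLp.norm_apply_le (s • (siteToE p.2 + centreOffset p.1) - y) k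
  have := le_trans (by simpa only [Real.norm_eq_abs] using hk) (hbt _ hb₀)
  rwa [atomArg_apply] at this

omit [Group G] [TopologicalSpace G] [IsTopologicalGroup G] [CompactSpace G] [MeasurableSpace G] [BorelSpace G] in
/-- **Carrier bound, physical units.**  For the atom of lattice scale `a/σ` and offset `σ⁻¹ • η`:
`|a(x_k + o_k) − η_k| ≤ tσ`. -/
theorem carrier_mul {b : SchwartzMap (EuclideanSpace ℝ (Fin 4)) ℝ} {t : ℝ} (hbt : ∀ u, b u ≠ 0 → ‖u‖ ≤ t)
    {q : Fin 4 × Fin 4} {a σ : ℝ} (hσ : 0 < σ) {η : EuclideanSpace ℝ (Fin 4)} {p : (Fin 4 × Fin 4) × (Fin 4 → ℤ)}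
    (h : atomWt b {q} (a / σ) (σ⁻¹ • η) p ≠ 0) (k : Fin 4) :
    |a * (((p.2 k : ℤ) : ℝ) + centreOffset p.1 k) - η k| ≤ t * σ := by
  have hc := carrier_coord hbt h k
  rw [PiLp.smul_apply, smul_eq_mul] at hc
  have e : a * (((p.2 k : ℤ) : ℝ) + centreOffset p.1 k) - η k =
      σ * (a / σ * (((p.2 k : ℤ) : ℝ) + centreOffset p.1 k) - σ⁻¹ * η k) := by
    field_simp
  rw [e, abs_mul, abs_of_pos hσ, mul_comm t σ]
  exact mul_le_mul_of_nonneg_left hc hσ.le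

omit [Group G] [TopologicalSpace G] [IsTopologicalGroup G] [CompactSpace G] [MeasurableSpace G] [BorelSpace G] in
/-- **H3, one direction.**  Slot centres `c_k + Λρ ≤ c'_k`: an integer hyperplane between the two atoms with both
carriers at lattice distance `≥ tσ/a + 2` resp. `≥ tσ'/a + 2`. -/
theorem separating_plane_aux {b : SchwartzMap (EuclideanSpace ℝ (Fin 4)) ℝ} {t : ℝ} (ht : 0 ≤ t)
    (hbt : ∀ u, b u ≠ 0 → ‖u‖ ≤ t) {a ρ Λ σ σ' : ℝ} (ha : 0 < a) (hρa : a ≤ ρ) (hΛ : 4 * t + 12 ≤ Λ)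
    (hσ : 0 < σ) (hσρ : σ ≤ ρ) (hσ' : 0 < σ') (hσ'ρ : σ' ≤ ρ) {η η' c c' : EuclideanSpace ℝ (Fin 4)}
    (hη : ‖η - c‖ ≤ 2 * ρ) (hη' : ‖η' - c'‖ ≤ 2 * ρ) {k : Fin 4} (hk : Λ * ρ ≤ c' k - c k)
    (q q' : Fin 4 × Fin 4) :
    ∃ cz : ℤ, (∀ p, atomWt b {q} (a / σ) (σ⁻¹ • η) p ≠ 0 → ((p.2 k : ℤ) : ℝ) + t / (a / σ) + 2 ≤ cz) ∧
      (∀ p, atomWt b {q'} (a / σ') (σ'⁻¹ • η') p ≠ 0 → (cz : ℝ) + t / (a / σ') + 2 ≤ ((p.2 k : ℤ) : ℝ)) := by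
  have hηk : |η k - c k| ≤ 2 * ρ :=
    le_trans (by simpa only [Real.norm_eq_abs, PiLp.sub_apply] using PiLp.norm_apply_le (η - c) k) hη
  have hη'k : |η' k - c' k| ≤ 2 * ρ :=
    le_trans (by simpa only [Real.norm_eq_abs, PiLp.sub_apply] using PiLp.norm_apply_le (η' - c') k) hη'
  have hρ : 0 < ρ := lt_of_lt_of_le ha hρa
  have htρ : t * σ ≤ t * ρ := mul_le_mul_of_nonneg_left hσρ ht
  have htρ' : t * σ' ≤ t * ρ := mul_le_mul_of_nonneg_left hσ'ρ ht
  have hΛρ : (4 * t + 12) * ρ ≤ Λ * ρ := mul_le_mul_of_nonneg_right hΛ hρ.le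
  have hgap : 4 * (t * ρ) + 8 * a ≤ η' k - η k := by
    nlinarith [abs_le.1 hηk, abs_le.1 hη'k]
  set z : ℝ := (η k + 2 * (t * ρ)) / a with hz
  have hz1 : z * a = η k + 2 * (t * ρ) := div_mul_cancel₀ _ ha.ne'
  have hc1 : z ≤ (⌈z⌉ : ℝ) := Int.le_ceil z
  have hc2 : (⌈z⌉ : ℝ) < z + 1 := Int.ceil_lt_add_one z
  refine ⟨⌈z⌉ + 2, fun p hp => ?_, fun p hp => ?_⟩
  · have hcar := abs_le.1 (carrier_mul hbt hσ hp k)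
    have ho := (centreOffset_apply_mem p.1 k).1
    have hax : a * ((p.2 k : ℤ) : ℝ) ≤ η k + t * σ := by nlinarith
    rw [div_div_eq_mul_div]
    push_cast
    have : ((p.2 k : ℤ) : ℝ) + t * σ / a ≤ z := by
      rw [le_div_iff₀ ha, add_mul, div_mul_cancel₀ _ ha.ne']
      nlinarith
    linarith
  · have hcar := abs_le.1 (carrier_mul hbt hσ' hp k)
    have ho := (centreOffset_apply_mem p.1 k).2
    have hax : η' k - t * σ' - a ≤ a * ((p.2 k : ℤ) : ℝ) := by nlinarith
    rw [div_div_eq_mul_div]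
    push_cast
    have key : a * (((⌈z⌉ : ℤ) : ℝ) + 2 + t * σ' / a + 2) ≤ a * ((p.2 k : ℤ) : ℝ) := by
      have e : a * (((⌈z⌉ : ℤ) : ℝ) + 2 + t * σ' / a + 2) = a * ((⌈z⌉ : ℤ) : ℝ) + t * σ' + 4 * a := by
        field_simp
        ring
      rw [e]
      nlinarith
    have := le_of_mul_le_mul_left key ha
    linarith

omit [Group G] [TopologicalSpace G] [IsTopologicalGroup G] [CompactSpace G] [MeasurableSpace G] [BorelSpace G] in
/-- **H3 `separating_plane`.**  Two slots of one Whitney piece of radius `ρ ≥ a` whose centres are `≥ Λρ` apart along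
axis `k` (`Λ ≥ 4t + 12`), synthesised into atoms of sizes `σ, σ' ≤ ρ` centred within `2ρ` of the slot centres, are
separated by an integer hyperplane `x_k = cz` with both carriers at lattice distance `≥ tσ/a + 2` (E1's side
condition; 28168's gap-2 clause follows since `t/s ≥ 0`). -/
theorem separating_plane {b : SchwartzMap (EuclideanSpace ℝ (Fin 4)) ℝ} {t : ℝ} (ht : 0 ≤ t)
    (hbt : ∀ u, b u ≠ 0 → ‖u‖ ≤ t) {a ρ Λ σ σ' : ℝ} (ha : 0 < a) (hρa : a ≤ ρ) (hΛ : 4 * t + 12 ≤ Λ)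
    (hσ : 0 < σ) (hσρ : σ ≤ ρ) (hσ' : 0 < σ') (hσ'ρ : σ' ≤ ρ) {η η' c c' : EuclideanSpace ℝ (Fin 4)}
    (hη : ‖η - c‖ ≤ 2 * ρ) (hη' : ‖η' - c'‖ ≤ 2 * ρ) {k : Fin 4} (hk : Λ * ρ ≤ |c k - c' k|)
    (q q' : Fin 4 × Fin 4) :
    ∃ cz : ℤ,
      ((∀ p, atomWt b {q} (a / σ) (σ⁻¹ • η) p ≠ 0 → ((p.2 k : ℤ) : ℝ) + t / (a / σ) + 2 ≤ cz) ∧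
        (∀ p, atomWt b {q'} (a / σ') (σ'⁻¹ • η') p ≠ 0 → (cz : ℝ) + t / (a / σ') + 2 ≤ ((p.2 k : ℤ) : ℝ))) ∨
      ((∀ p, atomWt b {q'} (a / σ') (σ'⁻¹ • η') p ≠ 0 → ((p.2 k : ℤ) : ℝ) + t / (a / σ') + 2 ≤ cz) ∧
        (∀ p, atomWt b {q} (a / σ) (σ⁻¹ • η) p ≠ 0 → (cz : ℝ) + t / (a / σ) + 2 ≤ ((p.2 k : ℤ) : ℝ))) := by
  rcases le_or_gt (c k) (c' k) with hle | hlt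
  · rw [abs_sub_comm, abs_of_nonneg (sub_nonneg.2 hle)] at hk
    obtain ⟨cz, h1, h2⟩ := separating_plane_aux ht hbt ha hρa hΛ hσ hσρ hσ' hσ'ρ hη hη' hk q q'
    exact ⟨cz, Or.inl ⟨h1, h2⟩⟩
  · rw [abs_of_pos (sub_pos.2 hlt)] at hk
    obtain ⟨cz, h1, h2⟩ := separating_plane_aux ht hbt ha hρa hΛ hσ' hσ'ρ hσ hσρ hη' hη hk q' q
    exact ⟨cz, Or.inr ⟨h1, h2⟩⟩

/-! ## §H2b Carriers are finite; the lattice sum of a tensor atom is 28168's finite cluster sum -/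

omit [Group G] [TopologicalSpace G] [IsTopologicalGroup G] [CompactSpace G] [MeasurableSpace G] [BorelSpace G] in
/-- The CARRIER of the atom `(q, s, y)` for a profile of support radius `t`: the plaquettes of non-zero weight, realised
as a `Finset` inside `{q} × (integer box)`. -/
def carrierFinset (b : SchwartzMap (EuclideanSpace ℝ (Fin 4)) ℝ) (q : Fin 4 × Fin 4) (s t : ℝ)
    (y : EuclideanSpace ℝ (Fin 4)) : Finset ((Fin 4 × Fin 4) × (Fin 4 → ℤ)) :=
  (({q} : Finset (Fin 4 × Fin 4)) ×ˢ
      Fintype.piFinset fun k : Fin 4 => Finset.Icc (⌊(y k - t) / s⌋ - 1) ⌈(y k + t) / s⌉).filter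
    fun p => atomWt b {q} s y p ≠ 0

omit [Group G] [TopologicalSpace G] [IsTopologicalGroup G] [CompactSpace G] [MeasurableSpace G] [BorelSpace G] in
/-- Membership in the carrier is exactly non-vanishing of the weight (`s > 0`, `t` a support radius of `b`). -/
theorem mem_carrierFinset {b : SchwartzMap (EuclideanSpace ℝ (Fin 4)) ℝ} {t : ℝ} (hbt : ∀ u, b u ≠ 0 → ‖u‖ ≤ t)
    {q : Fin 4 × Fin 4} {s : ℝ} (hs : 0 < s) {y : EuclideanSpace ℝ (Fin 4)}
    {p : (Fin 4 × Fin 4) × (Fin 4 → ℤ)} : p ∈ carrierFinset b q s t y ↔ atomWt b {q} s y p ≠ 0 := by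
  unfold carrierFinset
  rw [Finset.mem_filter]
  constructor
  · exact fun h => h.2
  · intro h
    refine ⟨?_, h⟩
    obtain ⟨⟨hq, -⟩, -⟩ := (atomWt_ne_zero_iff b {q} s y p).1 h
    rw [Finset.mem_product, Fintype.mem_piFinset]
    refine ⟨hq, fun k => ?_⟩
    have hc := abs_le.1 (carrier_coord hbt h k)
    have ho := centreOffset_apply_mem p.1 k
    rw [Finset.mem_Icc]
    constructor
    · have h1 : (y k - t) / s - 1 ≤ ((p.2 k : ℤ) : ℝ) := by
        rw [sub_le_iff_le_add, div_le_iff₀ hs]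
        nlinarith
      have h2 : ((⌊(y k - t) / s⌋ : ℤ) : ℝ) ≤ (y k - t) / s := Int.floor_le _
      have : ((⌊(y k - t) / s⌋ - 1 : ℤ) : ℝ) ≤ ((p.2 k : ℤ) : ℝ) := by push_cast; linarith
      exact_mod_cast this
    · have h1 : ((p.2 k : ℤ) : ℝ) ≤ (y k + t) / s := by
        rw [le_div_iff₀ hs]
        nlinarith
      have h2 : (y k + t) / s ≤ ((⌈(y k + t) / s⌉ : ℤ) : ℝ) := Int.le_ceil _
      have : ((p.2 k : ℤ) : ℝ) ≤ ((⌈(y k + t) / s⌉ : ℤ) : ℝ) := h1.trans h2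
      exact_mod_cast this

omit [Group G] [TopologicalSpace G] [IsTopologicalGroup G] [CompactSpace G] [MeasurableSpace G] [BorelSpace G] in
/-- Carrier plaquettes have the atom's orientation. -/
theorem fst_eq_of_mem_carrierFinset {b : SchwartzMap (EuclideanSpace ℝ (Fin 4)) ℝ} {t : ℝ} {q : Fin 4 × Fin 4}
    {s : ℝ} {y : EuclideanSpace ℝ (Fin 4)} {p : (Fin 4 × Fin 4) × (Fin 4 → ℤ)} (h : p ∈ carrierFinset b q s t y) :
    p.1 = q := by
  unfold carrierFinset at h
  exact Finset.mem_singleton.1 (Finset.mem_product.1 (Finset.mem_filter.1 h).1).1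

omit [Group G] [TopologicalSpace G] [IsTopologicalGroup G] [CompactSpace G] [MeasurableSpace G] [BorelSpace G] in
/-- The number of carrier plaquettes is at most `(2t/s + 4)⁴`. -/
theorem card_carrierFinset_le (b : SchwartzMap (EuclideanSpace ℝ (Fin 4)) ℝ) (q : Fin 4 × Fin 4) {s : ℝ}
    (hs : 0 < s) {t : ℝ} (ht : 0 ≤ t) (y : EuclideanSpace ℝ (Fin 4)) :
    ((carrierFinset b q s t y).card : ℝ) ≤ (2 * t / s + 4) ^ 4 := by
  unfold carrierFinset
  have h1 := Finset.card_filter_le (({q} : Finset (Fin 4 × Fin 4)) ×ˢ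
      Fintype.piFinset fun k : Fin 4 => Finset.Icc (⌊(y k - t) / s⌋ - 1) ⌈(y k + t) / s⌉)
    (fun p => atomWt b {q} s y p ≠ 0)
  rw [Finset.card_product, Finset.card_singleton, one_mul, Fintype.card_piFinset] at h1
  have h2 : ∀ k : Fin 4, ((Finset.Icc (⌊(y k - t) / s⌋ - 1) ⌈(y k + t) / s⌉).card : ℝ) ≤ 2 * t / s + 4 := by
    intro k
    rw [Int.card_Icc, ← Int.cast_natCast, Int.toNat_eq_max, Int.cast_max]
    push_cast
    refine max_le ?_ (by positivity)
    have e1 := Int.sub_one_lt_floor ((y k - t) / s)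
    have e2 := Int.ceil_lt_add_one ((y k + t) / s)
    have e3 : (y k + t) / s - (y k - t) / s = 2 * t / s := by rw [div_sub_div_same]; ring
    linarith
  have h1' : (((({q} : Finset (Fin 4 × Fin 4)) ×ˢ
      Fintype.piFinset fun k : Fin 4 => Finset.Icc (⌊(y k - t) / s⌋ - 1) ⌈(y k + t) / s⌉).filter
        fun p => atomWt b {q} s y p ≠ 0).card : ℝ) ≤
      ∏ k : Fin 4, ((Finset.Icc (⌊(y k - t) / s⌋ - 1) ⌈(y k + t) / s⌉).card : ℝ) := by
    exact_mod_cast h1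
  calc _ ≤ _ := h1'
    _ ≤ ∏ _k : Fin 4, (2 * t / s + 4) := Finset.prod_le_prod (fun k _ => by positivity) (fun k _ => h2 k)
    _ = (2 * t / s + 4) ^ 4 := by rw [Finset.prod_const, Finset.card_univ, Fintype.card_fin]

omit [Group G] [TopologicalSpace G] [IsTopologicalGroup G] [CompactSpace G] [MeasurableSpace G] [BorelSpace G] in
/-- Atom weights are bounded by the sup norm of the profile. -/
theorem abs_atomWt_le_norm (b : SchwartzMap (EuclideanSpace ℝ (Fin 4)) ℝ) (Q : Finset (Fin 4 × Fin 4)) (s : ℝ)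
    (y : EuclideanSpace ℝ (Fin 4)) (p : (Fin 4 × Fin 4) × (Fin 4 → ℤ)) :
    |atomWt b Q s y p| ≤ ‖b.toBoundedContinuousFunction‖ := by
  unfold atomWt
  split_ifs
  · simpa only [SchwartzMap.toBoundedContinuousFunction_apply, Real.norm_eq_abs] using
      b.toBoundedContinuousFunction.norm_coe_le_norm (s • (siteToE p.2 + centreOffset p.1) - y)
  · rw [abs_zero]; exact norm_nonneg _

omit [IsTopologicalGroup G] [CompactSpace G] [BorelSpace G] in
/-- Outside the product of the carriers' site shadows the tensor weight vanishes. -/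
theorem prod_weight_eq_zero_of_not_mem {n : ℕ} (q : Fin n → Fin 4 × Fin 4)
    (w : Fin n → (Fin 4 × Fin 4) × (Fin 4 → ℤ) → ℝ) (S : Fin n → Finset ((Fin 4 × Fin 4) × (Fin 4 → ℤ)))
    (hS : ∀ l p, w l p ≠ 0 → p ∈ S l) {x : Fin n → Site 4}
    (hx : x ∉ Fintype.piFinset fun l => (S l).image Prod.snd) : ∏ l, w l (q l, x l) = 0 := by
  classical
  rw [Fintype.mem_piFinset, not_forall] at hx
  obtain ⟨l, hl⟩ := hx
  have hw : w l (q l, x l) = 0 := by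
    by_contra h
    exact hl (Finset.mem_image.2 ⟨(q l, x l), hS l _ h, rfl⟩)
  exact Finset.prod_eq_zero (Finset.mem_univ l) hw

omit [IsTopologicalGroup G] [CompactSpace G] [BorelSpace G] in
/-- **H2b `tensorAtom_tsum_eq_piFinset`.**  The lattice sum of (moment × tensor weight) over site configurations is
the finite cluster sum of 28168 over `Fintype.piFinset S`, whenever `S_l ∋` every plaquette of non-zero `l`-th weight and
contains only plaquettes of orientation `q_l`. -/
theorem tensorAtom_tsum_eq_piFinset (r : LatticeRep G) (μ : Measure (LGConfig 4 G)) {n : ℕ}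
    (q : Fin n → Fin 4 × Fin 4) (w : Fin n → (Fin 4 × Fin 4) × (Fin 4 → ℤ) → ℝ)
    (S : Fin n → Finset ((Fin 4 × Fin 4) × (Fin 4 → ℤ))) (hS : ∀ l p, w l p ≠ 0 → p ∈ S l)
    (hSq : ∀ l, ∀ p ∈ S l, p.1 = q l) :
    ∑' x : Fin n → Site 4, stateMomentStr G r μ n q x * ∏ l, w l (q l, x l) =
      ∑ p ∈ Fintype.piFinset S, (∏ l, w l (p l)) * stateMomentStr G r μ n (fun l => (p l).1) (fun l => (p l).2) := by
  classical
  set T : Finset (Fin n → Site 4) := Fintype.piFinset fun l => (S l).image Prod.snd with hT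
  have hzero : ∀ x ∉ T, stateMomentStr G r μ n q x * ∏ l, w l (q l, x l) = 0 := fun x hx => by
    rw [prod_weight_eq_zero_of_not_mem q w S hS (by rwa [hT] at hx), mul_zero]
  rw [tsum_eq_sum hzero]
  refine Finset.sum_nbij' (fun x => fun l => (q l, x l)) (fun p => fun l => (p l).2) ?_ ?_ ?_ ?_ ?_
  · intro x hx
    rw [hT, Fintype.mem_piFinset] at hx
    rw [Fintype.mem_piFinset]
    intro l
    obtain ⟨p, hp, hp2⟩ := Finset.mem_image.1 (hx l)
    have : p = (q l, x l) := Prod.ext (hSq l p hp) hp2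
    rw [← this]
    exact hp
  · intro p hp
    rw [Fintype.mem_piFinset] at hp
    rw [hT, Fintype.mem_piFinset]
    exact fun l => Finset.mem_image_of_mem _ (hp l)
  · intro x _
    rfl
  · intro p hp
    rw [Fintype.mem_piFinset] at hp
    funext l
    exact Prod.ext (hSq l (p l) (hp l)).symm rfl
  · intro x _
    rw [mul_comm]

end Summit.QuantumFields.YangMills.Cruxes.AtomicCalibrationR.MirrorCalibration
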